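import Mathlib
import Literature.NumberTheory.LFunctions.Zhang2022.TypedAppendixA1
import HarnessLib

/-!
# Zhang (2022), Appendix A, display (A.4): the truncated Euler product for `𝓜₁(d,l;s)` near
# `s = 1` — the edge `(A.4) ⇐ §15.u032 ∧ §15.u033 ∧ §15.u034 (identity + analyticity)`, kernel-checked

Topic `Literature/NumberTheory/LFunctions/Zhang2022` (Landau–Siegel audit tree; verdict-neutral).
Y. Zhang, *Discrete mean estimates and the Landau–Siegel zero*, arXiv:2211.02515v1 (2022)
[Zhang2022LandauSiegel] — **an unrefereed manuscript under adjudication; nothing here asserts or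
denies its Theorems 1–2.** Campaign D-0069, DAG node `Z22:(A.4)` [Z22 p.103, (A.4), tex L5096–L5101],
typed as `Typed.AppendixA1.EqA_4` (`TypedAppendixA1`):

> In what follows assume `dl < P₂²`, `(dl,D) = 1` and `|s − 1| < 5α`. We have
> `𝓜₁(d,l;s) = ∏_{q<D} [(1−q^{−s−β₁})(1−q^{−s−β₂})/((1−q^{−s})(1−χ(q)q^{−s}))]
>              (1 + λ̃₁(q,d)Σ_r ξ₁(q^r;d,l)q^{−rs}) × (1 + O(D^{−c}))`.      (A.4)

Here `𝓜₁(d,l;·)` is the analytic continuation to `σ > 9/10` (§15 p. 84, tex L4190–L4212) of the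
printed `σ > 1` expression `ζ(s)L(s,χ)ζ(s+β₁)⁻¹ζ(s+β₂)⁻¹Σ_n λ̃₁(n,d)ξ₁(n;d,l)n^{−s}`, which the campaign
file `TypedSection15B` DEFINES as the Euler product `calM1 = ∏'_q calM1Factor q` and accompanies with
the claims `Step15_u032` («for `(q,dl) = 1`, `σ > 9/10`: the `q`-factor is `1 + O(q^{−19/10})`»),
`Step15_u033` («for `(q,dl) > 1`: `1 + O(q^{−9/10})`»), `Step15_u034` (the Euler product equals the
printed expression on `σ > 1`) and `Step15_u034an` (the product converges and is holomorphic on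
`σ > 9/10`). This file PROVES (A.4) FROM THOSE FOUR NODES (theorems only, no new definitions, no facts):

* `norm_prod_sub_one_le` — `‖∏_{i∈A} g(i) − 1‖ ≤ exp(Σ_{i∈A}‖g(i) − 1‖) − 1` (Mathlib's
  `Finset.norm_prod_one_add_sub_one_le`, finite products of factors close to `1`);
* `norm_hasProd_sub_prod_le` — if `∏' F = a` (unconditional product) and `‖F(i) − 1‖ ≤ b(i)` off a
  finite set `S` with `b ≥ 0` summable, then `‖a − ∏_{S} F‖ ≤ ‖∏_{S} F‖·(exp(Σ' b) − 1)` (every partial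
  product over `A ⊇ S` splits as `∏_S · ∏_{A∖S}`, and the closed condition passes to the limit);
* `card_primeFactors_ge_le` — the primes `q ≥ D` dividing `n < P` are at most `𝓛⁸` in number
  (`D^{#} ≤ n < P = e^{𝓛⁹}`), and `ell_pow_eight_le` — `𝓛⁸ ≤ 16⁸·D^{1/2}`;
* **`eqA_4_of : Step15_u032 c′ → Step15_u033 c′ → Step15_u034 c′ → Step15_u034an c′ → EqA_4 c′`** with
  `c = 2/5`: (i) the given continuation `M` and `calM1` are holomorphic on the half-plane `σ > 9/10`
  and agree on `σ > 1`, hence agree on the half-plane (identity theorem; `|s − 1| < 5α` puts `s` there,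
  `5α = 5π𝓛⁻⁹ < 1/10`); (ii) `calM1(s) = ∏'_q F_q` with `‖F_q − 1‖ ≤ C₂q^{−19/10}` for `q ∤ dl` and
  `≤ C₃q^{−9/10}` for `q ∣ dl` (`q ≥ D`), so the tail majorant sums to
  `≤ C₂ζ(3/2)D^{−2/5} + C₃·𝓛⁸D^{−9/10} ≤ C₁D^{−2/5}`, and `exp(x) − 1 ≤ x·eˣ` gives the relative error
  `C₁e^{C₁}·D^{−2/5}` against the finite product `∏_{q<D} F_q = ∏_{q<D} factorA4` (`factorA4_eq`).

WHAT THIS IS NOT: a proof of the four §15 input nodes (they remain CLAIMS of `TypedSection15B`), or of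
anything about Theorems 1–2 / Landau–Siegel zeros.

## References

* Y. Zhang, arXiv:2211.02515v1 (2022), App. A (A.4) p. 103; §15 p. 84 (the Euler product and
  continuation of `𝓜₁`). [cite: Zhang2022LandauSiegel, App. A (A.4)]
-/

noncomputable section

open Complex Real Filter Topology

namespace Literature.NumberTheory.LFunctions.Zhang2022.Typed.AppendixA1

open Literature.NumberTheory.LFunctions.Zhang2022
open Literature.NumberTheory.LFunctions.Zhang2022.Skeleton

/-! ## Products of factors close to `1` -/

/-- `‖∏_{i∈A} g(i) − 1‖ ≤ exp(Σ_{i∈A} ‖g(i) − 1‖) − 1` — Mathlib's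
`Finset.norm_prod_one_add_sub_one_le` with `f = g − 1`. [folklore] -/
private theorem norm_prod_sub_one_le {ι : Type*} (A : Finset ι) (g : ι → ℂ) :
    ‖∏ i ∈ A, g i - 1‖ ≤ Real.exp (∑ i ∈ A, ‖g i - 1‖) - 1 := by
  have h := A.norm_prod_one_add_sub_one_le (fun i => g i - 1)
  simpa only [add_sub_cancel] using h

/-- `eˣ − 1 ≤ x·eˣ` (from `1 − x ≤ e^{−x}`). [folklore] -/
private theorem exp_sub_one_le_mul_exp (x : ℝ) : Real.exp x - 1 ≤ x * Real.exp x := by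
  have h := Real.add_one_le_exp (-x)
  have hpos := Real.exp_pos x
  have h1 : (1 - x) * Real.exp x ≤ Real.exp (-x) * Real.exp x :=
    mul_le_mul_of_nonneg_right (by linarith) hpos.le
  rw [← Real.exp_add, neg_add_cancel, Real.exp_zero] at h1
  nlinarith

/-- **Tail control for an unconditional product.** If `∏' F = a` (`HasProd F a`), `S` is a finite
set, `b ≥ 0` is summable and `‖F(i) − 1‖ ≤ b(i)` for `i ∉ S`, then
`‖a − ∏_{i∈S} F(i)‖ ≤ ‖∏_{i∈S} F(i)‖ · (exp(Σ' b) − 1)`: every partial product over a finite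
`A ⊇ S` is `∏_S F · ∏_{A∖S} F` with `‖∏_{A∖S} F − 1‖ ≤ exp(Σ_{A∖S} b) − 1 ≤ exp(Σ' b) − 1`, and the
closed ball passes to the limit along `atTop`. [folklore] -/
private theorem norm_hasProd_sub_prod_le {ι : Type*} {F : ι → ℂ} {a : ℂ} (hF : HasProd F a)
    (S : Finset ι) {b : ι → ℝ} (hb0 : ∀ i, 0 ≤ b i) (hb : Summable b)
    (hFb : ∀ i ∉ S, ‖F i - 1‖ ≤ b i) :
    ‖a - ∏ i ∈ S, F i‖ ≤ ‖∏ i ∈ S, F i‖ * (Real.exp (∑' i, b i) - 1) := by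
  classical
  set P := ∏ i ∈ S, F i with hPdef
  set R := ‖P‖ * (Real.exp (∑' i, b i) - 1) with hRdef
  -- every partial product over `A ⊇ S` is within `R` of `P`
  have hA : ∀ A : Finset ι, S ≤ A → ‖∏ i ∈ A, F i - P‖ ≤ R := by
    intro A hSA
    have hsplit : ∏ i ∈ A, F i = P * ∏ i ∈ A \ S, F i := by
      rw [hPdef, ← Finset.prod_sdiff hSA, mul_comm]
    have h1 : ‖∏ i ∈ A \ S, F i - 1‖ ≤ Real.exp (∑' i, b i) - 1 := by
      refine (norm_prod_sub_one_le _ _).trans ?_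
      have hle : ∑ i ∈ A \ S, ‖F i - 1‖ ≤ ∑' i, b i :=
        calc ∑ i ∈ A \ S, ‖F i - 1‖ ≤ ∑ i ∈ A \ S, b i :=
              Finset.sum_le_sum fun i hi => hFb i (Finset.mem_sdiff.mp hi).2
          _ ≤ ∑' i, b i := hb.sum_le_tsum _ (fun i _ => hb0 i)
      linarith [Real.exp_le_exp.mpr hle]
    calc ‖∏ i ∈ A, F i - P‖ = ‖P * (∏ i ∈ A \ S, F i - 1)‖ := by rw [hsplit]; ring_nf
      _ = ‖P‖ * ‖∏ i ∈ A \ S, F i - 1‖ := norm_mul _ _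
      _ ≤ R := mul_le_mul_of_nonneg_left h1 (norm_nonneg _)
  -- pass to the limit
  have hT : Tendsto (fun A : Finset ι => ∏ i ∈ A, F i) atTop (𝓝 a) := hF
  have hclosed : IsClosed {z : ℂ | ‖z - P‖ ≤ R} :=
    isClosed_le (continuous_id.sub continuous_const).norm continuous_const
  exact hclosed.mem_of_tendsto hT (Filter.eventually_atTop.mpr ⟨S, fun A hA' => hA A hA'⟩)

/-! ## Counting the large prime factors; `𝓛⁸` against a power of `D` -/

/-- If `D^k ≤ n < P = e^{𝓛⁹}` with `𝓛 = log D > 0`, then `k ≤ 𝓛⁸`. [cite: Zhang2022LandauSiegel, §2 (2.6)] -/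
theorem nat_le_ell_pow_eight {D k n : ℕ} (hℓ : 0 < ell D) (hk : D ^ k ≤ n) (hn : (n : ℝ) < bigP D) :
    (k : ℝ) ≤ ell D ^ 8 := by
  have hD1 : (1 : ℝ) < D := by
    have : 0 < Real.log D := hℓ
    by_contra h
    push Not at h
    have := Real.log_nonpos (Nat.cast_nonneg D) h
    linarith
  have hDk : (D : ℝ) ^ k < Real.exp (ell D ^ 9) := by
    calc (D : ℝ) ^ k = ((D ^ k : ℕ) : ℝ) := by push_cast; ring
      _ ≤ n := by exact_mod_cast hk
      _ < bigP D := hn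
      _ = Real.exp (ell D ^ 9) := rfl
  have hlog : (k : ℝ) * ell D < ell D ^ 9 := by
    have := Real.log_lt_log (pow_pos (by linarith) k) hDk
    rwa [Real.log_exp, Real.log_pow, ell] at this
  have h9 : ell D ^ 9 = ell D ^ 8 * ell D := by ring
  rw [h9] at hlog
  exact le_of_lt (lt_of_mul_lt_mul_right hlog hℓ.le)

/-- **The primes `q ≥ D` dividing `n` are few**: if `n < P`, then
`#{q ∣ n prime : D ≤ q} ≤ 𝓛⁸` (their product divides `n`, so `D^{#} ≤ n < P = e^{𝓛⁹}`).
[cite: Zhang2022LandauSiegel, App. A (A.4)] -/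
theorem card_primeFactors_ge_le {D n : ℕ} (hℓ : 0 < ell D) (hn0 : 0 < n) (hn : (n : ℝ) < bigP D) :
    (((n.primeFactors.filter fun q => D ≤ q).card : ℕ) : ℝ) ≤ ell D ^ 8 := by
  set T := n.primeFactors.filter fun q => D ≤ q with hT
  have h1 : D ^ T.card ≤ ∏ q ∈ T, q :=
    Finset.pow_card_le_prod T (fun q => q) D fun q hq => (Finset.mem_filter.mp hq).2
  have h2 : ∏ q ∈ T, q ≤ ∏ q ∈ n.primeFactors, q :=
    Finset.prod_le_prod_of_subset_of_one_le' (Finset.filter_subset _ _)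
      fun q hq _ => (Nat.prime_of_mem_primeFactors hq).one_lt.le
  have h3 : ∏ q ∈ n.primeFactors, q ≤ n := Nat.le_of_dvd hn0 (Nat.prod_primeFactors_dvd n)
  exact nat_le_ell_pow_eight hℓ (h1.trans (h2.trans h3)) hn

/-- `𝓛⁸ ≤ 16⁸ · D^{1/2}` for `D ≥ 1` (`log D = 16 log D^{1/16} ≤ 16 D^{1/16}`). [folklore] -/
private theorem ell_pow_eight_le {D : ℕ} (hD : 0 < D) : ell D ^ 8 ≤ 16 ^ 8 * (D : ℝ) ^ (1 / 2 : ℝ) := by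
  have hD0 : (0 : ℝ) < D := by exact_mod_cast hD
  have hr : 0 < (D : ℝ) ^ (1 / 16 : ℝ) := Real.rpow_pos_of_pos hD0 _
  have hlog : ell D = 16 * Real.log ((D : ℝ) ^ (1 / 16 : ℝ)) := by
    rw [ell, Real.log_rpow hD0]; ring
  have hle : ell D ≤ 16 * (D : ℝ) ^ (1 / 16 : ℝ) := by
    rw [hlog]
    have := Real.log_le_sub_one_of_pos hr
    linarith
  have hℓ0 : 0 ≤ ell D := by rw [ell]; exact Real.log_natCast_nonneg D
  calc ell D ^ 8 ≤ (16 * (D : ℝ) ^ (1 / 16 : ℝ)) ^ 8 := pow_le_pow_left₀ hℓ0 hle 8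
    _ = 16 ^ 8 * ((D : ℝ) ^ (1 / 16 : ℝ)) ^ 8 := by ring
    _ = 16 ^ 8 * (D : ℝ) ^ (1 / 2 : ℝ) := by
        rw [← Real.rpow_natCast ((D : ℝ) ^ (1 / 16 : ℝ)) 8, ← Real.rpow_mul hD0.le]
        norm_num

/-- `P₂² ≤ P` (`P₂ = P^{1/2}T^{−10}`, `T ≥ 1`). [cite: Zhang2022LandauSiegel, §2 (2.21)] -/
theorem P2_sq_le_bigP (D : ℕ) : Skeleton.P2 D ^ 2 ≤ bigP D := by
  have hP0 : 0 < bigP D := Real.exp_pos _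
  have hT1 : 1 ≤ bigT D := Real.one_le_exp (by rw [ell]; positivity)
  have hsq : (bigP D ^ (0.5 : ℝ)) ^ 2 = bigP D := by
    rw [← Real.rpow_natCast (bigP D ^ (0.5 : ℝ)) 2, ← Real.rpow_mul hP0.le]
    norm_num
  rw [Skeleton.P2, div_pow, hsq]
  exact div_le_self hP0.le (one_le_pow₀ (one_le_pow₀ hT1))

/-- `5α ≤ 1/10` once `𝓛 ≥ 3` (`α = π𝓛⁻⁹`). [cite: Zhang2022LandauSiegel, §2 (2.10)] -/
theorem five_alpha_le {D : ℕ} (hℓ : 3 ≤ ell D) : 5 * alpha D ≤ 1 / 10 := by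
  have hπ : π < 4 := Real.pi_lt_four
  have h9 : (3 : ℝ) ^ 9 ≤ ell D ^ 9 := pow_le_pow_left₀ (by norm_num) hℓ 9
  rw [alpha, bigP, Real.log_exp]
  rw [show 5 * (π / ell D ^ 9) = 5 * π / ell D ^ 9 by ring, div_le_iff₀ (by positivity)]
  nlinarith

/-- `log D ≥ 3` once `D ≥ ⌈e³⌉`. [folklore] -/
private theorem three_le_ell_of_ceil_le {D : ℕ} (hD : ⌈Real.exp 3⌉₊ ≤ D) : 3 ≤ ell D := by
  have h : Real.exp 3 ≤ D := le_trans (Nat.le_ceil _) (by exact_mod_cast hD)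
  exact (Real.le_log_iff_exp_le (lt_of_lt_of_le (Real.exp_pos _) h)).mpr h

/-! ## The edge `(A.4) ⇐ §15.u032, u033, u034, u034an` -/

/-- **(A.4) from the §15 p. 84 nodes** (DAG `Z22:(A.4)`, [Z22 p.103, tex L5096–L5101]): for `D`
large, under (A), for `dl < P₂²`, `(dl,D) = 1`, any continuation `M` of `𝓜₁(d,l;·)` to `σ > 9/10` and
`|s − 1| < 5α`,
`‖M(s) − ∏_{q<D} factorA4(q)‖ ≤ C₁e^{C₁}·D^{−2/5}·‖∏_{q<D} factorA4(q)‖`.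
Proof: `M = calM1` on `σ > 9/10` (identity theorem from `Step15_u034` on `σ > 1` and the
holomorphy `Step15_u034an`); `calM1(s) = ∏'_q F_q` with `F_q = calM1Factor q = factorA4 q`
(`factorA4_eq`); for `q ≥ D`, `‖F_q − 1‖ ≤ C₂q^{−19/10}` if `q ∤ dl` (`Step15_u032`) and
`≤ C₃q^{−9/10}` if `q ∣ dl` (`Step15_u033`); the majorant sums to
`≤ C₂ζ(3/2)D^{−2/5} + C₃·#{q ∣ dl : q ≥ D}·D^{−9/10} ≤ C₁D^{−2/5}` (`#{…} ≤ 𝓛⁸ ≤ 16⁸D^{1/2}`), and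
`norm_hasProd_sub_prod_le` + `eˣ − 1 ≤ xeˣ` give the relative error.
[cite: Zhang2022LandauSiegel, App. A (A.4)] -/
theorem eqA_4_of (c' : ℝ) (h32 : Typed.Section15B.Step15_u032 c')
    (h33 : Typed.Section15B.Step15_u033 c') (h34 : Typed.Section15B.Step15_u034 c')
    (h34an : Typed.Section15B.Step15_u034an c') : EqA_4 c' := by
  classical
  obtain ⟨C₂, h32⟩ := h32
  obtain ⟨C₃, h33⟩ := h33
  obtain ⟨D₀, hD₀⟩ := (h32.and h33).and h34an
  -- the constants
  set C₂' : ℝ := max C₂ 0 with hC₂'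
  set C₃' : ℝ := max C₃ 0 with hC₃'
  set Z : ℝ := ∑' n : ℕ, (n : ℝ) ^ (-(3 / 2 : ℝ)) with hZdef
  have hZsum : Summable fun n : ℕ => (n : ℝ) ^ (-(3 / 2 : ℝ)) :=
    Real.summable_nat_rpow.mpr (by norm_num)
  have hZ0 : 0 ≤ Z := tsum_nonneg fun n => Real.rpow_nonneg (Nat.cast_nonneg n) _
  set C₁ : ℝ := C₂' * Z + C₃' * 16 ^ 8 with hC₁
  have hC₂'0 : 0 ≤ C₂' := le_max_right _ _
  have hC₃'0 : 0 ≤ C₃' := le_max_right _ _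
  have hC₁0 : 0 ≤ C₁ := by positivity
  refine ⟨2 / 5, by norm_num, C₁ * Real.exp C₁, max D₀ ⌈Real.exp 3⌉₊,
    fun D _ χ hD hq hp hA d l hd hl hdl _ M hM hMeq s hs => ?_⟩
  obtain ⟨⟨e32, e33⟩, e34an⟩ := hD₀ D χ (le_trans (le_max_left _ _) hD) hq hp
  have hℓ3 : 3 ≤ ell D := three_le_ell_of_ceil_le (le_trans (le_max_right _ _) hD)
  have hℓ0 : 0 < ell D := by linarith
  have hDpos : 0 < D := Nat.pos_of_ne_zero (NeZero.ne D)
  have hD0 : (0 : ℝ) < D := by exact_mod_cast hDpos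
  have hD1 : (1 : ℝ) ≤ D := by exact_mod_cast hDpos
  have hdl0 : 0 < d * l := Nat.mul_pos hd hl
  -- `s` lies in the half-plane `σ > 9/10`
  have hsU : 9 / 10 < s.re := by
    have h5 := five_alpha_le hℓ3
    have hre : |(s - 1).re| ≤ ‖s - 1‖ := Complex.abs_re_le_norm _
    rw [sub_re, one_re] at hre
    have := (abs_le.mp hre).1
    linarith
  -- `M = calM1` on the half-plane (identity theorem)
  obtain ⟨hmult, hdiff⟩ := e34an hA d l hd hl
  have hU : IsOpen {z : ℂ | 9 / 10 < z.re} := isOpen_lt continuous_const Complex.continuous_re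
  have hV : IsOpen {z : ℂ | 1 < z.re} := isOpen_lt continuous_const Complex.continuous_re
  have hEq : Set.EqOn M (fun z => Typed.Section15B.calM1 c' χ d l z) {z : ℂ | 9 / 10 < z.re} := by
    refine (hM.analyticOnNhd hU).eqOn_of_preconnected_of_eventuallyEq (hdiff.analyticOnNhd hU)
      (convex_halfSpace_re_gt (9 / 10)).isPreconnected (z₀ := 2)
      (by show (9 : ℝ) / 10 < (2 : ℂ).re; norm_num) ?_
    refine Filter.eventuallyEq_of_mem (hV.mem_nhds (by show (1 : ℝ) < (2 : ℂ).re; norm_num))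
      fun z hz => ?_
    have hz' : 1 < z.re := hz
    rw [hMeq z hz', frakm1_eq, ← h34 D χ d l hd hl z hz']
  have hMs : M s = Typed.Section15B.calM1 c' χ d l s := hEq hsU
  -- the factors and the finite part
  set F : Nat.Primes → ℂ := fun q => Typed.Section15B.calM1Factor c' χ (q : ℕ) d l s with hFdef
  set S : Finset Nat.Primes := (Nat.primesBelow D).subtype Nat.Prime with hSdef
  have hP : ∏ q ∈ Nat.primesBelow D, factorA4 c' χ d l s q = ∏ q ∈ S, F q := by
    have h1 : ∏ q ∈ S, F q = ∏ q ∈ (Nat.primesBelow D).filter Nat.Prime,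
        Typed.Section15B.calM1Factor c' χ q d l s :=
      Finset.prod_subtype_eq_prod_filter (fun q : ℕ => Typed.Section15B.calM1Factor c' χ q d l s)
    rw [h1, Finset.filter_true_of_mem fun q hq => Nat.prime_of_mem_primesBelow hq]
    exact Finset.prod_congr rfl fun q _ => factorA4_eq c' χ d l s q
  have hcal : Typed.Section15B.calM1 c' χ d l s = ∏' q, F q := rfl
  have hmultF : Multipliable F := hmult s hsU
  -- the majorant `b = b₁ + b₂` of `‖F_q − 1‖` off `S`
  set b₁ : Nat.Primes → ℝ := fun q =>
    if (q : ℕ) < D then 0 else C₂' * ((q : ℕ) : ℝ) ^ (-(19 / 10 : ℝ)) with hb₁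
  set b₂ : Nat.Primes → ℝ := fun q =>
    if (q : ℕ) < D then 0 else
      if (q : ℕ) ∣ d * l then C₃' * ((q : ℕ) : ℝ) ^ (-(9 / 10 : ℝ)) else 0 with hb₂
  have hb₁0 : ∀ q, 0 ≤ b₁ q := fun q => by
    simp only [hb₁]; split_ifs <;> positivity
  have hb₂0 : ∀ q, 0 ≤ b₂ q := fun q => by
    simp only [hb₂]; split_ifs <;> positivity
  have hb0 : ∀ q, 0 ≤ b₁ q + b₂ q := fun q => add_nonneg (hb₁0 q) (hb₂0 q)
  -- `‖F_q − 1‖ ≤ b q` for `q ∉ S`, i.e. `q ≥ D`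
  have hFb : ∀ q ∉ S, ‖F q - 1‖ ≤ b₁ q + b₂ q := by
    intro q hqS
    have hqprime : (q : ℕ).Prime := q.prop
    have hqD : ¬ (q : ℕ) < D := fun h =>
      hqS (Finset.mem_subtype.mpr (Nat.mem_primesBelow.mpr ⟨h, hqprime⟩))
    have hq0 : (0 : ℝ) < ((q : ℕ) : ℝ) := by exact_mod_cast hqprime.pos
    by_cases hc : Nat.Coprime (q : ℕ) (d * l)
    · have h := e32 hA (q : ℕ) d l hqprime hd hl hc s hsU
      have h' : ‖F q - 1‖ ≤ b₁ q := by
        simp only [hb₁, if_neg hqD]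
        exact h.trans (mul_le_mul_of_nonneg_right (le_max_left _ _) (Real.rpow_nonneg hq0.le _))
      linarith [hb₂0 q]
    · have h := e33 hA (q : ℕ) d l hqprime hd hl hc s hsU
      have hdvd : (q : ℕ) ∣ d * l := not_not.mp (mt hqprime.coprime_iff_not_dvd.mpr hc)
      have h' : ‖F q - 1‖ ≤ b₂ q := by
        simp only [hb₂, if_neg hqD, if_pos hdvd]
        exact h.trans (mul_le_mul_of_nonneg_right (le_max_left _ _) (Real.rpow_nonneg hq0.le _))
      linarith [hb₁0 q]
  -- summability and size of `b₁`: `Σ' b₁ ≤ C₂'·Z·D^{−2/5}`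
  set g₁ : ℕ → ℝ := fun n => if n < D then 0 else C₂' * (n : ℝ) ^ (-(19 / 10 : ℝ)) with hg₁
  have hg₁0 : ∀ n, 0 ≤ g₁ n := fun n => by simp only [hg₁]; split_ifs <;> positivity
  have hg₁le : ∀ n, g₁ n ≤ C₂' * (D : ℝ) ^ (-(2 / 5 : ℝ)) * (n : ℝ) ^ (-(3 / 2 : ℝ)) := by
    intro n
    simp only [hg₁]
    split_ifs with hn
    · positivity
    · have hn' : (D : ℝ) ≤ n := by exact_mod_cast not_lt.mp hn
      have hn0 : (0 : ℝ) < n := lt_of_lt_of_le hD0 hn'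
      have hsplit : (n : ℝ) ^ (-(19 / 10 : ℝ)) = (n : ℝ) ^ (-(2 / 5 : ℝ)) * (n : ℝ) ^ (-(3 / 2 : ℝ)) := by
        rw [← Real.rpow_add hn0]; norm_num
      have hmono : (n : ℝ) ^ (-(2 / 5 : ℝ)) ≤ (D : ℝ) ^ (-(2 / 5 : ℝ)) :=
        Real.rpow_le_rpow_of_nonpos hD0 hn' (by norm_num)
      rw [hsplit, ← mul_assoc]
      gcongr
  have hg₁sum : Summable g₁ :=
    Summable.of_nonneg_of_le hg₁0 hg₁le ((hZsum.mul_left _))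
  have hb₁sum : Summable b₁ := by
    have : b₁ = g₁ ∘ (fun q : Nat.Primes => (q : ℕ)) := by
      funext q; simp only [hb₁, hg₁, Function.comp]
    rw [this]
    exact hg₁sum.comp_injective Subtype.val_injective
  have htsum₁ : ∑' q, b₁ q ≤ C₂' * Z * (D : ℝ) ^ (-(2 / 5 : ℝ)) := by
    have h1 : ∑' q, b₁ q ≤ ∑' n, g₁ n :=
      hb₁sum.tsum_le_tsum_of_inj (fun q : Nat.Primes => (q : ℕ)) Subtype.val_injective
        (fun n _ => hg₁0 n) (fun q => by simp only [hb₁, hg₁]; exact le_rfl) hg₁sum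
    have h2 : ∑' n, g₁ n ≤ ∑' n : ℕ, C₂' * (D : ℝ) ^ (-(2 / 5 : ℝ)) * (n : ℝ) ^ (-(3 / 2 : ℝ)) :=
      hg₁sum.tsum_le_tsum hg₁le (hZsum.mul_left _)
    rw [tsum_mul_left] at h2
    calc ∑' q, b₁ q ≤ C₂' * (D : ℝ) ^ (-(2 / 5 : ℝ)) * Z := h1.trans h2
      _ = C₂' * Z * (D : ℝ) ^ (-(2 / 5 : ℝ)) := by ring
  -- summability and size of `b₂`: finitely supported, `Σ' b₂ ≤ C₃'·𝓛⁸·D^{−9/10} ≤ C₃'·16⁸·D^{−2/5}`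
  set S₂ : Finset Nat.Primes := (d * l).primeFactors.subtype Nat.Prime with hS₂def
  have hb₂zero : ∀ q ∉ S₂, b₂ q = 0 := by
    intro q hq
    have hndvd : ¬ (q : ℕ) ∣ d * l := fun h =>
      hq (Finset.mem_subtype.mpr (Nat.mem_primeFactors.mpr ⟨q.prop, h, hdl0.ne'⟩))
    simp only [hb₂, if_neg hndvd]
    split_ifs <;> rfl
  have hb₂sum : Summable b₂ := summable_of_ne_finset_zero hb₂zero
  have htsum₂ : ∑' q, b₂ q ≤ C₃' * 16 ^ 8 * (D : ℝ) ^ (-(2 / 5 : ℝ)) := by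
    rw [tsum_eq_sum hb₂zero]
    -- move to the sum over the prime factors of `dl` in `ℕ`
    set g₂ : ℕ → ℝ := fun n => if n < D then 0 else
      if n ∣ d * l then C₃' * (n : ℝ) ^ (-(9 / 10 : ℝ)) else 0 with hg₂
    have hsum : ∑ q ∈ S₂, b₂ q = ∑ n ∈ (d * l).primeFactors, g₂ n := by
      have h1 : ∑ q ∈ S₂, b₂ q = ∑ n ∈ (d * l).primeFactors.filter Nat.Prime, g₂ n :=
        Finset.sum_subtype_eq_sum_filter g₂
      rw [h1, Finset.filter_true_of_mem fun n hn => Nat.prime_of_mem_primeFactors hn]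
    rw [hsum]
    set T := (d * l).primeFactors.filter fun q => D ≤ q with hTdef
    have hle : ∀ n ∈ (d * l).primeFactors,
        g₂ n ≤ if D ≤ n then C₃' * (D : ℝ) ^ (-(9 / 10 : ℝ)) else 0 := by
      intro n _
      simp only [hg₂]
      by_cases hn : n < D
      · rw [if_pos hn, if_neg (not_le.mpr hn)]
      · rw [if_neg hn, if_pos (not_lt.mp hn)]
        have hn' : (D : ℝ) ≤ n := by exact_mod_cast not_lt.mp hn
        split_ifs
        · exact mul_le_mul_of_nonneg_left (Real.rpow_le_rpow_of_nonpos hD0 hn' (by norm_num)) hC₃'0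
        · positivity
    have hcard : ((T.card : ℕ) : ℝ) ≤ ell D ^ 8 := by
      have hdlP : ((d * l : ℕ) : ℝ) < bigP D := hdl.trans_le (P2_sq_le_bigP D)
      exact card_primeFactors_ge_le hℓ0 hdl0 hdlP
    have h8 := ell_pow_eight_le hDpos
    have hpow : (D : ℝ) ^ (1 / 2 : ℝ) * (D : ℝ) ^ (-(9 / 10 : ℝ)) = (D : ℝ) ^ (-(2 / 5 : ℝ)) := by
      rw [← Real.rpow_add hD0]; norm_num
    calc ∑ n ∈ (d * l).primeFactors, g₂ n
        ≤ ∑ n ∈ (d * l).primeFactors, (if D ≤ n then C₃' * (D : ℝ) ^ (-(9 / 10 : ℝ)) else 0) :=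
          Finset.sum_le_sum hle
      _ = T.card * (C₃' * (D : ℝ) ^ (-(9 / 10 : ℝ))) := by
          rw [Finset.sum_ite, Finset.sum_const_zero, add_zero, Finset.sum_const, nsmul_eq_mul]
      _ ≤ ell D ^ 8 * (C₃' * (D : ℝ) ^ (-(9 / 10 : ℝ))) := by gcongr
      _ ≤ 16 ^ 8 * (D : ℝ) ^ (1 / 2 : ℝ) * (C₃' * (D : ℝ) ^ (-(9 / 10 : ℝ))) := by gcongr
      _ = C₃' * 16 ^ 8 * ((D : ℝ) ^ (1 / 2 : ℝ) * (D : ℝ) ^ (-(9 / 10 : ℝ))) := by ring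
      _ = C₃' * 16 ^ 8 * (D : ℝ) ^ (-(2 / 5 : ℝ)) := by rw [hpow]
  -- the total majorant
  have hbsum : Summable fun q => b₁ q + b₂ q := hb₁sum.add hb₂sum
  have htsum : ∑' q, (b₁ q + b₂ q) ≤ C₁ * (D : ℝ) ^ (-(2 / 5 : ℝ)) := by
    rw [hb₁sum.tsum_add hb₂sum, hC₁]
    nlinarith [htsum₁, htsum₂]
  have htsum0 : 0 ≤ ∑' q, (b₁ q + b₂ q) := tsum_nonneg hb0
  have hDneg : (D : ℝ) ^ (-(2 / 5 : ℝ)) ≤ 1 :=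
    Real.rpow_le_one_of_one_le_of_nonpos hD1 (by norm_num)
  have htsumC : ∑' q, (b₁ q + b₂ q) ≤ C₁ :=
    htsum.trans (by nlinarith)
  -- the tail lemma
  have key := norm_hasProd_sub_prod_le hmultF.hasProd S hb0 hbsum hFb
  -- assemble
  have hexp : Real.exp (∑' q, (b₁ q + b₂ q)) - 1 ≤ C₁ * Real.exp C₁ * (D : ℝ) ^ (-(2 / 5 : ℝ)) :=
    calc Real.exp (∑' q, (b₁ q + b₂ q)) - 1
        ≤ (∑' q, (b₁ q + b₂ q)) * Real.exp (∑' q, (b₁ q + b₂ q)) := exp_sub_one_le_mul_exp _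
      _ ≤ (C₁ * (D : ℝ) ^ (-(2 / 5 : ℝ))) * Real.exp C₁ := by
          gcongr
      _ = C₁ * Real.exp C₁ * (D : ℝ) ^ (-(2 / 5 : ℝ)) := by ring
  calc ‖M s - ∏ q ∈ Nat.primesBelow D, factorA4 c' χ d l s q‖
      = ‖(∏' q, F q) - ∏ q ∈ S, F q‖ := by rw [hMs, hcal, hP]
    _ ≤ ‖∏ q ∈ S, F q‖ * (Real.exp (∑' q, (b₁ q + b₂ q)) - 1) := key
    _ ≤ ‖∏ q ∈ S, F q‖ * (C₁ * Real.exp C₁ * (D : ℝ) ^ (-(2 / 5 : ℝ))) :=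
        mul_le_mul_of_nonneg_left hexp (norm_nonneg _)
    _ = C₁ * Real.exp C₁ * (D : ℝ) ^ (-(2 / 5 : ℝ)) *
          ‖∏ q ∈ Nat.primesBelow D, factorA4 c' χ d l s q‖ := by rw [hP]; ring

end Literature.NumberTheory.LFunctions.Zhang2022.Typed.AppendixA1

end
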